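import Mathlib.Analysis.InnerProductSpace.Projection.Basic
import Mathlib.Analysis.InnerProductSpace.Projection.Submodule
import Mathlib.RepresentationTheory.Continuous.Basic
import Mathlib.Topology.Algebra.InfiniteSum.Real
import Mathlib.Analysis.Normed.Group.InfiniteSum

/-!
# Telescoping for a monotone chain of orthogonal projections, and shift covariance

Pure Hilbert-space bookkeeping behind the `L²`-bound of Whittaker coefficients of automorphic forms
along the torus of `GL₂` at a finite place (Rankin–Selberg theory at `s = 1`): for a monotone chain
`K : ℤ → Submodule 𝕜 E` of complete subspaces with orthogonal projections `P_i`, the differences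
`D_i x = P_{i+1} x - P_i x` satisfy `Σ_{a ≤ i < b} ‖D_i x‖² = ‖P_b x‖² - ‖P_a x‖² ≤ ‖x‖²`
(Pythagoras; `sum_norm_sq_sub_eq`, `sum_norm_sq_sub_le`), so `i ↦ ‖D_i x‖²` is summable with sum
`≤ ‖x‖²` (`finset_sum_norm_sq_sub_le`, `summable_norm_sq_sub`: summability over `ℤ` together with
the bound on the `tsum`); and if a linear isometric isomorphism `U`
shifts the chain, `U(K_i) = K_{i+1}`, then `D_{i+1}(U x) = U (D_i x)` (`starProjection_shift`,
`sub_starProjection_shift`), whence `Σ_{k ≥ 0} ‖D_j(U^k x)‖² ≤ ‖x‖²` for every `j`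
(`sum_range_norm_sq_sub_iterate_le`, with the `k`-fold iterate `U^[k]`): in the application `K_i` is the space of vectors fixed by the
unipotent subgroup `n(𝔭^{c-i})` of `GL₂(K_v)` acting on `L²(GL₂(K) \ GL₂(𝔸_K))` and `U = R(a(ϖ))`.

The second part (`Literature.RepresentationTheory`) packages the chain `K_i = E^{S_i}` of fixed subspaces
of an isometric `ContRepresentation` for an antitone family of SUBSETS `S_i ⊆ G` conjugated into each
other by `a` (`fixedSubmodule`, stated for sets because the application conjugates the pieces
`ι_v(n(𝔭^i))` as images `(g ↦ a g a⁻¹) '' S_i`); for a subgroup `H` this is Mathlib's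
`(π.restrict H.subtype).invariants` (`fixedSubmodule_coe_eq_invariants`, the bridge to the form used by
the automorphic files). [folklore]
-/

open scoped InnerProductSpace
open Finset

namespace Literature.Analysis.OperatorTheory

variable {𝕜 : Type*} [RCLike 𝕜] {E : Type*} [NormedAddCommGroup E] [InnerProductSpace 𝕜 E]

/-- **Pythagoras for nested projections**: for `U ≤ V`,
`‖P_V x‖² = ‖P_U x‖² + ‖P_V x - P_U x‖²`. [folklore] -/
theorem norm_sq_starProjection_eq_add_of_le {U V : Submodule 𝕜 E} [U.HasOrthogonalProjection]
    [V.HasOrthogonalProjection] (h : U ≤ V) (x : E) :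
    ‖V.starProjection x‖ ^ 2 = ‖U.starProjection x‖ ^ 2 + ‖V.starProjection x - U.starProjection x‖ ^ 2 := by
  have h1 : U.starProjection (V.starProjection x) = U.starProjection x := by
    have := congrArg (fun T : E →L[𝕜] E => T x) (Submodule.starProjection_comp_starProjection_of_le h)
    simpa using this
  -- `P_U y ⊥ y - P_U y` with `y = P_V x`
  set y := V.starProjection x with hy
  have horth : ⟪U.starProjection y, y - U.starProjection y⟫_𝕜 = 0 := by
    have hmem : y - U.starProjection y ∈ Uᗮ := U.sub_starProjection_mem_orthogonal y
    exact Submodule.inner_right_of_mem_orthogonal (U.starProjection_apply_mem y) hmem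
  have hsum : y = U.starProjection y + (y - U.starProjection y) := by abel
  have := norm_add_sq_eq_norm_sq_add_norm_sq_of_inner_eq_zero _ _ horth
  rw [← hsum] at this
  rw [h1] at this
  simp only [sq]
  exact this

/-- **Telescoping**: for a monotone chain `K` of complete subspaces,
`Σ_{i ∈ [a, a+n)} ‖P_{i+1} x - P_i x‖² = ‖P_{a+n} x‖² - ‖P_a x‖²`. [folklore] -/
theorem sum_norm_sq_sub_eq (K : ℤ → Submodule 𝕜 E) [∀ i, (K i).HasOrthogonalProjection]
    (hK : Monotone K) (x : E) (a : ℤ) (n : ℕ) :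
    ∑ i ∈ range n, ‖(K (a + i + 1)).starProjection x - (K (a + i)).starProjection x‖ ^ 2 =
      ‖(K (a + n)).starProjection x‖ ^ 2 - ‖(K a).starProjection x‖ ^ 2 := by
  induction n with
  | zero => simp
  | succ n ih =>
    rw [sum_range_succ, ih]
    have hle : K (a + n) ≤ K (a + n + 1) := hK (by linarith)
    have := norm_sq_starProjection_eq_add_of_le hle x
    have hcast : (a + ((n + 1 : ℕ) : ℤ)) = a + n + 1 := by push_cast; ring
    rw [hcast]
    linarith

/-- The telescoping sum is bounded by `‖x‖²`. [folklore] -/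
theorem sum_norm_sq_sub_le (K : ℤ → Submodule 𝕜 E) [∀ i, (K i).HasOrthogonalProjection]
    (hK : Monotone K) (x : E) (a : ℤ) (n : ℕ) :
    ∑ i ∈ range n, ‖(K (a + i + 1)).starProjection x - (K (a + i)).starProjection x‖ ^ 2 ≤
      ‖x‖ ^ 2 := by
  rw [sum_norm_sq_sub_eq K hK x a n]
  have h1 : ‖(K (a + n)).starProjection x‖ ^ 2 ≤ ‖x‖ ^ 2 := by
    have := (K (a + n)).norm_starProjection_apply_le x
    exact pow_le_pow_left₀ (norm_nonneg _) this 2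
  nlinarith [sq_nonneg ‖(K a).starProjection x‖]

/-- Every finite sum of the `‖P_{i+1} x - P_i x‖²` is bounded by `‖x‖²`. [folklore] -/
theorem finset_sum_norm_sq_sub_le (K : ℤ → Submodule 𝕜 E) [∀ i, (K i).HasOrthogonalProjection]
    (hK : Monotone K) (x : E) (s : Finset ℤ) :
    ∑ i ∈ s, ‖(K (i + 1)).starProjection x - (K i).starProjection x‖ ^ 2 ≤ ‖x‖ ^ 2 := by
  set f : ℤ → ℝ := fun i => ‖(K (i + 1)).starProjection x - (K i).starProjection x‖ ^ 2 with hf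
  have hf0 : ∀ i, 0 ≤ f i := fun i => sq_nonneg _
  by_cases hs : s.Nonempty
  · set a := s.min' hs with ha
    set b := s.max' hs with hb
    have hsub : s ⊆ Finset.image (fun i : ℕ => a + i) (range ((b - a).toNat + 1)) := by
      intro i hi
      rw [Finset.mem_image]
      refine ⟨(i - a).toNat, Finset.mem_range.2 ?_, ?_⟩
      · have h1 : a ≤ i := s.min'_le i hi
        have h2 : i ≤ b := s.le_max' i hi
        omega
      · have h1 : a ≤ i := s.min'_le i hi
        omega
    calc ∑ i ∈ s, f i ≤ ∑ i ∈ Finset.image (fun i : ℕ => a + i) (range ((b - a).toNat + 1)), f i :=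
          Finset.sum_le_sum_of_subset_of_nonneg hsub fun i _ _ => hf0 i
      _ = ∑ i ∈ range ((b - a).toNat + 1), f (a + i) := by
          rw [Finset.sum_image]
          intro i _ j _ h
          simpa using h
      _ ≤ ‖x‖ ^ 2 := by
          have := sum_norm_sq_sub_le K hK x a ((b - a).toNat + 1)
          simpa [hf, add_assoc] using this
  · rw [Finset.not_nonempty_iff_eq_empty.1 hs, Finset.sum_empty]
    positivity

/-- **Summability over `ℤ`** of `i ↦ ‖P_{i+1} x - P_i x‖²`, with sum `≤ ‖x‖²`. [folklore] -/
theorem summable_norm_sq_sub (K : ℤ → Submodule 𝕜 E) [∀ i, (K i).HasOrthogonalProjection]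
    (hK : Monotone K) (x : E) :
    Summable (fun i : ℤ => ‖(K (i + 1)).starProjection x - (K i).starProjection x‖ ^ 2) ∧
      ∑' i : ℤ, ‖(K (i + 1)).starProjection x - (K i).starProjection x‖ ^ 2 ≤ ‖x‖ ^ 2 := by
  have hsum : Summable (fun i : ℤ => ‖(K (i + 1)).starProjection x - (K i).starProjection x‖ ^ 2) :=
    summable_of_sum_le (fun i => sq_nonneg _) (finset_sum_norm_sq_sub_le K hK x)
  exact ⟨hsum, hsum.tsum_le_of_sum_le (finset_sum_norm_sq_sub_le K hK x)⟩

/-- **Shift covariance of projections**: if the linear isometric isomorphism `U` maps `K_i` onto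
`K_{i+1}`, then `P_{i+1}(U x) = U (P_i x)`. [folklore] -/
theorem starProjection_shift (K : ℤ → Submodule 𝕜 E) [∀ i, (K i).HasOrthogonalProjection]
    (U : E ≃ₗᵢ[𝕜] E) (hU : ∀ i, (K i).map (U.toLinearEquiv : E →ₗ[𝕜] E) = K (i + 1))
    (i : ℤ) (x : E) :
    (K (i + 1)).starProjection (U x) = U ((K i).starProjection x) := by
  have h := Submodule.starProjection_map_apply U (K i) (U x)
  rw [U.symm_apply_apply] at h
  rw [← h]
  -- the two projections are onto the same subspace (`HasOrthogonalProjection` is a `Prop`)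
  have key : ∀ (V W : Submodule 𝕜 E) [V.HasOrthogonalProjection] [W.HasOrthogonalProjection],
      V = W → ∀ z, V.starProjection z = W.starProjection z := by
    intro V W _ _ hVW z
    subst hVW
    rfl
  exact key _ _ (hU i).symm (U x)

/-- Shift covariance of the differences: `D_{i+1}(U x) = U (D_i x)`. [folklore] -/
theorem sub_starProjection_shift (K : ℤ → Submodule 𝕜 E) [∀ i, (K i).HasOrthogonalProjection]
    (U : E ≃ₗᵢ[𝕜] E) (hU : ∀ i, (K i).map (U.toLinearEquiv : E →ₗ[𝕜] E) = K (i + 1))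
    (i : ℤ) (x : E) :
    (K (i + 1 + 1)).starProjection (U x) - (K (i + 1)).starProjection (U x) =
      U ((K (i + 1)).starProjection x - (K i).starProjection x) := by
  rw [map_sub, starProjection_shift K U hU (i + 1) x, starProjection_shift K U hU i x]

/-- Iterated shift covariance: `P_{i+k}(U^k x) = U^k (P_i x)`, stated with the `k`-fold iterate of
`U`. [folklore] -/
theorem starProjection_shift_iterate (K : ℤ → Submodule 𝕜 E) [∀ i, (K i).HasOrthogonalProjection]
    (U : E ≃ₗᵢ[𝕜] E) (hU : ∀ i, (K i).map (U.toLinearEquiv : E →ₗ[𝕜] E) = K (i + 1))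
    (k : ℕ) (i : ℤ) (x : E) :
    (K (i + k)).starProjection (U^[k] x) = U^[k] ((K i).starProjection x) := by
  induction k generalizing x with
  | zero => simp
  | succ k ih =>
    rw [Function.iterate_succ_apply', Function.iterate_succ_apply', ← ih,
      ← starProjection_shift K U hU (i + k)]
    push_cast
    ring_nf

/-- **Main corollary.** `Σ_{k < N} ‖D_j(U^k x)‖² ≤ ‖x‖²` for every `j` and `N`: along the orbit
of `x` under the shift, the `j`-th difference projections have square-summable norms. [folklore] -/
theorem sum_range_norm_sq_sub_iterate_le (K : ℤ → Submodule 𝕜 E) [∀ i, (K i).HasOrthogonalProjection]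
    (hK : Monotone K) (U : E ≃ₗᵢ[𝕜] E)
    (hU : ∀ i, (K i).map (U.toLinearEquiv : E →ₗ[𝕜] E) = K (i + 1)) (j : ℤ) (x : E) (N : ℕ) :
    ∑ k ∈ range N, ‖(K (j + 1)).starProjection (U^[k] x) - (K j).starProjection (U^[k] x)‖ ^ 2 ≤
      ‖x‖ ^ 2 := by
  -- `D_j(U^k x) = U^k (D_{j-k} x)` and `U^k` is an isometry
  have hnorm : ∀ (k : ℕ) (z : E), ‖U^[k] z‖ = ‖z‖ := by
    intro k z
    induction k generalizing z with
    | zero => simp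
    | succ k ih => rw [Function.iterate_succ_apply', U.norm_map, ih]
  have hlin : ∀ (k : ℕ) (z w : E), U^[k] (z - w) = U^[k] z - U^[k] w := by
    intro k z w
    induction k generalizing z w with
    | zero => simp
    | succ k ih => rw [Function.iterate_succ_apply', Function.iterate_succ_apply',
        Function.iterate_succ_apply', ih, map_sub]
  have hterm : ∀ k : ℕ, ‖(K (j + 1)).starProjection (U^[k] x) - (K j).starProjection (U^[k] x)‖ ^ 2 =
      ‖(K (j - k + 1)).starProjection x - (K (j - k)).starProjection x‖ ^ 2 := by
    intro k
    have h1 := starProjection_shift_iterate K U hU k (j - k + 1) x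
    have h2 := starProjection_shift_iterate K U hU k (j - k) x
    rw [show j - (k : ℤ) + 1 + k = j + 1 by ring] at h1
    rw [show j - (k : ℤ) + k = j by ring] at h2
    rw [h1, h2, ← hlin, hnorm]
  simp_rw [hterm]
  -- reindex `k ↦ j - k` (injective) and apply the finite-sum bound
  have hinj : Set.InjOn (fun k : ℕ => j - (k : ℤ)) (range N : Set ℕ) := by
    intro a _ b _ h
    have : (a : ℤ) = b := by
      have := h
      simp only at this
      linarith
    exact_mod_cast this
  have := finset_sum_norm_sq_sub_le K hK x (Finset.image (fun k : ℕ => j - (k : ℤ)) (range N))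
  rw [Finset.sum_image hinj] at this
  exact this

end Literature.Analysis.OperatorTheory

/-! ### Chains of fixed-vector subspaces of an isometric representation -/

namespace Literature.RepresentationTheory

open Literature.Analysis.OperatorTheory Finset

variable {G : Type*} [Group G]
  {E : Type*} [NormedAddCommGroup E] [InnerProductSpace ℂ E] [CompleteSpace E]
  (π : ContRepresentation ℂ G E) (hiso : ∀ g x, ‖π g x‖ = ‖x‖)

/-- The closed subspace of vectors fixed by every element of a set `S ⊆ G`. [folklore] -/
def fixedSubmodule (S : Set G) : Submodule ℂ E where
  carrier := {x | ∀ g ∈ S, π g x = x}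
  add_mem' := fun hx hy g hg => by rw [map_add, hx g hg, hy g hg]
  zero_mem' := fun g _ => map_zero _
  smul_mem' := fun c x hx g hg => by rw [map_smul, hx g hg]

omit [CompleteSpace E] in
/-- Membership in `fixedSubmodule`. [folklore] -/
@[simp]
theorem mem_fixedSubmodule {S : Set G} {x : E} : x ∈ fixedSubmodule π S ↔ ∀ g ∈ S, π g x = x :=
  Iff.rfl

omit [CompleteSpace E] in
/-- **Bridge to Mathlib**: for a subgroup `H`, `fixedSubmodule π H` is the space of invariants of the
restricted representation `π|_H` (`ContRepresentation.invariants`). [folklore] -/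
theorem fixedSubmodule_coe_eq_invariants (H : Subgroup G) :
    fixedSubmodule π (H : Set G) = (π.restrict H.subtype).invariants := by
  ext x
  simp only [mem_fixedSubmodule, ContRepresentation.mem_invariants, ContRepresentation.restrict_apply,
    Subgroup.coe_subtype, Subtype.forall, SetLike.mem_coe]

omit [CompleteSpace E] in
/-- `fixedSubmodule` is antitone in the set. [folklore] -/
theorem fixedSubmodule_antitone {S T : Set G} (h : S ⊆ T) : fixedSubmodule π T ≤ fixedSubmodule π S :=
  fun _ hx g hg => hx g (h hg)

omit [CompleteSpace E] in
/-- `fixedSubmodule` is closed. [folklore] -/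
theorem isClosed_fixedSubmodule (S : Set G) : IsClosed (fixedSubmodule π S : Set E) := by
  have : (fixedSubmodule π S : Set E) = ⋂ g ∈ S, {x | π g x = x} := by
    ext x; simp [fixedSubmodule]
  rw [this]
  exact isClosed_biInter fun g _ => isClosed_eq (π g).continuous continuous_id

/-- `fixedSubmodule` admits an orthogonal projection (it is complete). [folklore] -/
instance hasOrthogonalProjection_fixedSubmodule (S : Set G) :
    (fixedSubmodule π S).HasOrthogonalProjection := by
  haveI : CompleteSpace (fixedSubmodule π S) := (isClosed_fixedSubmodule π S).completeSpace_coe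
  exact Submodule.HasOrthogonalProjection.ofCompleteSpace _

/-- An isometric representation operator as a linear isometric isomorphism. [folklore] -/
def toLinearIsometryEquiv (a : G) : E ≃ₗᵢ[ℂ] E where
  toLinearEquiv :=
    { toFun := π a
      invFun := π a⁻¹
      map_add' := map_add _
      map_smul' := map_smul _
      left_inv := fun x => by
        rw [← mul_apply_eq_comp, ← map_mul, inv_mul_cancel, map_one, one_apply_eq_self]
      right_inv := fun x => by
        rw [← mul_apply_eq_comp, ← map_mul, mul_inv_cancel, map_one, one_apply_eq_self] }
  norm_map' := hiso a

omit [CompleteSpace E] in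
/-- `toLinearIsometryEquiv π hiso a` acts as `π a`. [folklore] -/
@[simp]
theorem toLinearIsometryEquiv_apply (a : G) (x : E) : toLinearIsometryEquiv π hiso a x = π a x := rfl

omit [CompleteSpace E] in
/-- **Transport of fixed vectors**: `π(a)` maps the vectors fixed by `S` onto the vectors fixed by
`a S a⁻¹`. [folklore] -/
theorem map_fixedSubmodule_eq (a : G) (S : Set G) :
    (fixedSubmodule π S).map ((toLinearIsometryEquiv π hiso a).toLinearEquiv : E →ₗ[ℂ] E) =
      fixedSubmodule π ((fun g => a * g * a⁻¹) '' S) := by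
  ext y
  simp only [Submodule.mem_map, mem_fixedSubmodule, Set.forall_mem_image]
  constructor
  · rintro ⟨x, hx, rfl⟩ g hg
    change π (a * g * a⁻¹) (π a x) = π a x
    rw [← mul_apply_eq_comp, ← map_mul, mul_assoc, inv_mul_cancel, mul_one, map_mul,
      mul_apply_eq_comp]
    change π a (π g x) = π a x
    rw [hx g hg]
  · intro hy
    refine ⟨π a⁻¹ y, fun g hg => ?_, ?_⟩
    · have h := hy hg
      -- `π g (π a⁻¹ y) = π a⁻¹ (π (a g a⁻¹) y) = π a⁻¹ y`
      have : π g (π a⁻¹ y) = π a⁻¹ (π (a * g * a⁻¹) y) := by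
        rw [← mul_apply_eq_comp, ← mul_apply_eq_comp, ← map_mul, ← map_mul, ← mul_assoc,
          ← mul_assoc, inv_mul_cancel, one_mul]
      rw [this, h]
    · change π a (π a⁻¹ y) = y
      rw [← mul_apply_eq_comp, ← map_mul, mul_inv_cancel, map_one, one_apply_eq_self]

include hiso in
/-- **Chains of fixed-vector subspaces.** Let `S : ℤ → Set G` be antitone and let `a ∈ G`
conjugate `S i` onto `S (i+1)`. Then the fixed subspaces `K_i = E^{S_i}` form a monotone chain
shifted by `π(a)`, so for every `j` and `N`,
`Σ_{k<N} ‖D_j(π(a)^k x)‖² ≤ ‖x‖²`, `D_j = P_{K_{j+1}} - P_{K_j}`. [folklore] -/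
theorem sum_range_norm_sq_sub_fixedSubmodule_le (S : ℤ → Set G) (hS : Antitone S) (a : G)
    (ha : ∀ i, (fun g => a * g * a⁻¹) '' S i = S (i + 1)) (j : ℤ) (x : E) (N : ℕ) :
    ∑ k ∈ range N, ‖(fixedSubmodule π (S (j + 1))).starProjection (π (a ^ k) x) -
        (fixedSubmodule π (S j)).starProjection (π (a ^ k) x)‖ ^ 2 ≤ ‖x‖ ^ 2 := by
  set K : ℤ → Submodule ℂ E := fun i => fixedSubmodule π (S i) with hK
  have hKmono : Monotone K := fun i i' h => fixedSubmodule_antitone π (hS h)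
  set U := toLinearIsometryEquiv π hiso a with hU
  have hshift : ∀ i, (K i).map (U.toLinearEquiv : E →ₗ[ℂ] E) = K (i + 1) := by
    intro i
    simp only [hK, hU]
    rw [map_fixedSubmodule_eq, ha]
  have hiter : ∀ (k : ℕ) (z : E), U^[k] z = π (a ^ k) z := by
    intro k z
    induction k generalizing z with
    | zero => simp [one_apply_eq_self]
    | succ k ih =>
      rw [Function.iterate_succ_apply', ih, pow_succ', map_mul, mul_apply_eq_comp]
      rfl
  have := sum_range_norm_sq_sub_iterate_le K hKmono U hshift j x N
  simpa only [hK, hiter] using this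

end Literature.RepresentationTheory
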